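import Summits.BirchSwinnertonDyer.BirchSwinnertonDyer.Theorems.EisensteinPrimesTwistDeformationFullAtSelmer
import Summits.BirchSwinnertonDyer.BirchSwinnertonDyer.Theorems.EisensteinPrimesTwistDeformationSigmaSupply
import Summits.BirchSwinnertonDyer.BirchSwinnertonDyer.Theorems.EisensteinPrimesGoodLatticeOmegaPrelims
import Literature.NumberTheory.IwasawaTheory.Greenberg2006.InducedCohomologyComparison
import Literature.NumberTheory.IwasawaTheory.PruferPontryaginDual
import HarnessLib

/-!
# Route `EisensteinPrimes` (rung K5), crux 2 `GoodLatticeBDPValue`, line `halves` v5, stub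
# `stub_noPseudoNull`, road (γ): THE INSTANCE, SECOND CONSUMPTION — every input of
# `twistDeformation_fullAtSelmer_isAlmostDivisible` that the tree now supplies is discharged
# (helper for stmt-BirchSwinnertonDyer-19032)

Cell `bsd-eis`, seat `bsd-eis-k5-c2` (gen 9). Since the instance theorem
`GreenbergFullAtSelmer.twistDeformation_fullAtSelmer_isAlmostDivisible` (gen 8, p519555) landed, the
tree acquired: the Prüfer brick (`Literature.NumberTheory.IwasawaTheory.QpModZp.*`, k5-ty g10
p518442 + p521553), Greenberg 2006 Prop. 3.2 as a named fact
(`Greenberg2006.prop32_cohomology_isCofinitelyGenerated`, p519514), Greenberg 2006 Thm. 3 Λ-free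
(`Greenberg2006.thm3_twistDeformation_cohomology_addEquiv`, p520619) and the `σ`-supply
(`GreenbergFullAtSelmer.exists_resGal_apply_ne_one_of_surjective`, p520977). This file CONSUMES them:

* §1 `K` imaginary quadratic, `𝔭 ≠ 𝔭̄` both above `p` ⇒ all archimedean places complex, `r₂ = 1`,
  `e(𝔭̄|p)f(𝔭̄|p) = 1`, and the places above `p` are `𝔭, 𝔭̄` (fundamental identity for `K/ℚ`);
* §2 `LEO(𝐃)` and `corank_Λ H²(K_Σ/K, 𝐃) = 0` from ONE vanishing `H²(K_Σ/K̃_∞, A) = 0` (the planned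
  support statement "TwistDeformationH2Vanishing", kept as the hypothesis `hH2`) through Thm. 3 in
  degree `2` (`….subsingleton`);
* §3 the consumer `twistDeformation_fullAtSelmer_isAlmostDivisible_of_linearEquiv`: the instance data
  `hA/jQ/hinjQ/hsurjQ/jU/hinjU/hsurjU/hcyc` from ONE `e : A ≃ₗ[ℤ_p] ℚ_p/ℤ_p`, `hsup` from joint
  surjectivity of `(κ₁, κ₂)`, `hcfg` from Prop. 3.2, `hK/hr₂/hdeg/hSp` from §1, `hLEO/h2` from §2.

WHAT STAYS NAMED after this file (hypotheses): the SEVEN published facts (Greenberg 2016 Props.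
4.1.1, 4.2.2; Greenberg 2006 Props. 3.2, 4.1, 4.2, §5 A, Thm. 3); `hH2 : H²(K_Σ/K̃_∞, A) = 0`
(weak Leopoldt above `K̃_∞ ⊇ K^{cyc}` for the twisted coefficient `A` — Nguyen Quang Do 1984 Thm. 2.2
over the splitting field of `ρ₀` plus a prime-to-`p` descent; NOT in the tree); and
`hSel : corank_Λ S_{𝓛_𝔭}(K, 𝐃) = 0` (Rubin 1991 Thm. 5.3 (iii) / Bleher et al. 2020 §3.3 through the
Shapiro bridge K-Sh; NOT in the tree). Theorems only; no named fact introduced, no `sorry`.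
HONEST FRAMING: conditional on the named inputs; closes nothing by itself (`--supports`).
References: [Greenberg2016Selmer] Prop. 4.1.1 (c) p. 15, §4.3 p. 20; [Greenberg2006] Thm. 3 p. 342,
Prop. 3.2 p. 358, Props. 4.1–4.2 pp. 367–368, §5 A p. 373; HOME/k5-c2-MEMO-8.md §3.
-/

set_option autoImplicit false
set_option linter.dupNamespace false

noncomputable section

open scoped Classical
open NumberField IsDedekindDomain Field PowerSeries
open Literature.NumberTheory.EllipticCurves Literature.NumberTheory.GaloisRepresentations
  Literature.NumberTheory.IwasawaTheory Literature.NumberTheory.IwasawaTheory.Greenberg2016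
  Literature.NumberTheory.IwasawaTheory.Greenberg2006
  Summit.BirchSwinnertonDyer.BirchSwinnertonDyer.Theorems.TwistDeformationCofree

namespace Summit.BirchSwinnertonDyer.BirchSwinnertonDyer.Theorems.GreenbergFullAtSelmer

/-! ## §1. Imaginary quadratic `K`, `p = 𝔭𝔭̄` split -/

section Split

variable {K : Type} [Field K] [NumberField K] {p : ℕ} [hp : Fact p.Prime]

/-- **`p = 𝔭𝔭̄` split in a quadratic field: exactly two primes above `p`, each of degree one.**
For `[K:ℚ] = 2` and two distinct primes `𝔭 ≠ 𝔭̄` of `𝓞_K` containing `p`: the set of primes over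
`(p)` has exactly two members and `e·f = 1` at each (fundamental identity `#{𝔓 | p}·e·f = 2` for the
Galois extension `K/ℚ`). [folklore] -/
theorem ncard_primesOver_eq_two_and_deg_one_of_ne (h2 : Module.finrank ℚ K = 2)
    {𝔭 𝔭bar : HeightOneSpectrum (𝓞 K)} (hp𝔭 : ((p : ℕ) : 𝓞 K) ∈ 𝔭.asIdeal)
    (hp𝔭bar : ((p : ℕ) : 𝓞 K) ∈ 𝔭bar.asIdeal) (hne : 𝔭bar ≠ 𝔭) :
    ((Ideal.span {(p : ℤ)}).primesOver (𝓞 K)).ncard = 2 ∧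
      ∀ {𝔮 : HeightOneSpectrum (𝓞 K)}, ((p : ℕ) : 𝓞 K) ∈ 𝔮.asIdeal →
        𝔮.asIdeal.ramificationIdx ℤ * 𝔮.asIdeal.inertiaDeg ℤ = 1 := by
  haveI : Algebra.IsQuadraticExtension ℚ K := ⟨h2⟩
  haveI : (Ideal.span {(p : ℤ)}).IsPrime :=
    (Ideal.span_singleton_prime (by exact_mod_cast hp.out.ne_zero)).mpr
      (Int.prime_iff_natAbs_prime.mpr (by simpa using hp.out))
  set G := K ≃ₐ[ℚ] K
  have hG : Nat.card G = 2 := by rw [IsGalois.card_aut_eq_finrank, h2]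
  have hid := Ideal.ncard_primesOver_mul_ramificationIdxIn_mul_inertiaDegIn
    (Ideal.span {(p : ℤ)}) (𝓞 K) G
  rw [hG] at hid
  set T := (Ideal.span {(p : ℤ)}).primesOver (𝓞 K) with hT
  have hfin : T.Finite := by
    refine Set.finite_of_ncard_ne_zero fun h0 ↦ ?_
    rw [h0] at hid
    omega
  have hne' : 𝔭.asIdeal ≠ 𝔭bar.asIdeal := fun e ↦ hne (HeightOneSpectrum.ext e.symm)
  have hsub : ({𝔭.asIdeal, 𝔭bar.asIdeal} : Set (Ideal (𝓞 K))) ⊆ T := by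
    intro x hx
    rcases hx with rfl | rfl
    · exact EisensteinPrimesMuLambda.asIdeal_mem_primesOver_of_natCast_mem hp𝔭
    · exact EisensteinPrimesMuLambda.asIdeal_mem_primesOver_of_natCast_mem hp𝔭bar
  have h2le : 2 ≤ T.ncard := by
    have := Set.ncard_le_ncard hsub hfin
    rwa [Set.ncard_pair hne'] at this
  have he : (Ideal.span {(p : ℤ)}).ramificationIdxIn (𝓞 K) ≠ 0 := Ideal.ramificationIdxIn_ne_zero G
  have hf : (Ideal.span {(p : ℤ)}).inertiaDegIn (𝓞 K) ≠ 0 := Ideal.inertiaDegIn_ne_zero G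
  have hef : 1 ≤ (Ideal.span {(p : ℤ)}).ramificationIdxIn (𝓞 K) *
      (Ideal.span {(p : ℤ)}).inertiaDegIn (𝓞 K) := Nat.one_le_iff_ne_zero.mpr (mul_ne_zero he hf)
  have hT2 : T.ncard = 2 := by nlinarith
  refine ⟨hT2, fun {𝔮} h𝔮 ↦ ?_⟩
  haveI := (EisensteinPrimesMuLambda.asIdeal_mem_primesOver_of_natCast_mem (K := K) h𝔮).2
  rw [← Ideal.ramificationIdxIn_eq_ramificationIdx (Ideal.span {(p : ℤ)}) 𝔮.asIdeal G,
    ← Ideal.inertiaDegIn_eq_inertiaDeg (Ideal.span {(p : ℤ)}) 𝔮.asIdeal G]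
  rw [hT2] at hid
  omega

/-- **The primes above a split `p` are `𝔭` and `𝔭̄`** (`[K:ℚ] = 2`, `𝔭 ≠ 𝔭̄` above `p`).
[folklore] -/
theorem eq_or_eq_of_natCast_mem_of_ne (h2 : Module.finrank ℚ K = 2)
    {𝔭 𝔭bar : HeightOneSpectrum (𝓞 K)} (hp𝔭 : ((p : ℕ) : 𝓞 K) ∈ 𝔭.asIdeal)
    (hp𝔭bar : ((p : ℕ) : 𝓞 K) ∈ 𝔭bar.asIdeal) (hne : 𝔭bar ≠ 𝔭) {𝔮 : HeightOneSpectrum (𝓞 K)}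
    (h𝔮 : ((p : ℕ) : 𝓞 K) ∈ 𝔮.asIdeal) : 𝔮 = 𝔭 ∨ 𝔮 = 𝔭bar := by
  set T := (Ideal.span {(p : ℤ)}).primesOver (𝓞 K) with hT
  have hcard : T.ncard = 2 := (ncard_primesOver_eq_two_and_deg_one_of_ne h2 hp𝔭 hp𝔭bar hne).1
  have hfin : T.Finite := Set.finite_of_ncard_ne_zero (by rw [hcard]; norm_num)
  by_contra h
  push Not at h
  have hne' : 𝔭.asIdeal ≠ 𝔭bar.asIdeal := fun e ↦ hne (HeightOneSpectrum.ext e.symm)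
  have h𝔮𝔭 : 𝔮.asIdeal ≠ 𝔭.asIdeal := fun e ↦ h.1 (HeightOneSpectrum.ext e)
  have h𝔮𝔭bar : 𝔮.asIdeal ≠ 𝔭bar.asIdeal := fun e ↦ h.2 (HeightOneSpectrum.ext e)
  have hsub : ({𝔭.asIdeal, 𝔭bar.asIdeal, 𝔮.asIdeal} : Set (Ideal (𝓞 K))) ⊆ T := by
    intro x hx
    rcases hx with rfl | rfl | rfl
    · exact EisensteinPrimesMuLambda.asIdeal_mem_primesOver_of_natCast_mem hp𝔭
    · exact EisensteinPrimesMuLambda.asIdeal_mem_primesOver_of_natCast_mem hp𝔭bar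
    · exact EisensteinPrimesMuLambda.asIdeal_mem_primesOver_of_natCast_mem h𝔮
  have h3 : ({𝔭.asIdeal, 𝔭bar.asIdeal, 𝔮.asIdeal} : Set (Ideal (𝓞 K))).ncard = 3 := by
    rw [Set.ncard_insert_of_notMem (by simp [hne', h𝔮𝔭.symm]) (by simp),
      Set.ncard_pair h𝔮𝔭bar.symm]
  have hle := Set.ncard_le_ncard hsub hfin
  rw [h3, hcard] at hle
  omega

/-- An imaginary quadratic field has exactly one complex place. [folklore] -/
theorem nrComplexPlaces_eq_one_of_isImaginaryQuadratic (hK : IsImaginaryQuadratic K) :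
    InfinitePlace.nrComplexPlaces K = 1 := by
  haveI := hK.2
  have h1 : Module.finrank ℚ K = 2 * InfinitePlace.nrComplexPlaces K := IsTotallyComplex.finrank K
  have h2 := hK.1
  omega

end Split

/-! ## §2. `LEO(𝐃)` and `corank H²(K_Σ/K, 𝐃) = 0` from `H²(K_Σ/K̃_∞, A) = 0` through Thm. 3 -/

/-- `p`-primarity in the facts' `ℤ`-form from the brick's `ℕ`-form. [folklore] -/
theorem exists_zpow_smul_eq_zero_of_nsmul {p : ℕ} {A : Type} [AddCommGroup A]
    (hA : ∀ a : A, ∃ k : ℕ, p ^ k • a = 0) (a : A) : ∃ n : ℕ, (p ^ n : ℤ) • a = 0 := by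
  obtain ⟨k, hk⟩ := hA a
  exact ⟨k, by rw [← hk, ← natCast_zsmul, Nat.cast_pow]⟩

section H2

variable {K : Type} [Field K] [NumberField K] {S : Set (HeightOneSpectrum (𝓞 K))} {p : ℕ} [Fact p.Prime]
  {A : Type} [AddCommGroup A] [Module ℤ_[p] A] [TopologicalSpace A] [DiscreteTopology A]
  [ContinuousSMul ℤ_[p] A]
  [TopologicalSpace (PowerSeries ℤ_[p])] [TopologicalSpace (PowerSeries (PowerSeries ℤ_[p]))]
  [IsTopologicalAddGroup (IndModule₂ ℤ_[p] p A)]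
  [ContinuousSMul (PowerSeries (PowerSeries ℤ_[p])) (IndModule₂ ℤ_[p] p A)]
  (hS : ∀ v : HeightOneSpectrum (𝓞 K), ((p : ℕ) : 𝓞 K) ∈ v.asIdeal → v ∈ S)
  (κ₁ κ₂ : ZpExtension K p) (ρ₀ : ContinuousRep (GaloisGroupUnramifiedOutside K S) ℤ_[p] A)

/-- **`H²(K_Σ/K, 𝐃) = 0` for the twist deformation from `H²(K_Σ/K̃_∞, A) = 0`** — Greenberg 2006
Thm. 3 in degree `2` (Λ-free form suffices), for a jointly surjective pair `(κ₁, κ₂)`.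
[cite: Greenberg2006, Thm. 3 p. 342 L13–14] [cite: Lim2012PoitouTate, Prop. 5.2.2, Lemma 5.3.1] -/
theorem subsingleton_H2_twistDeformation_of_subsingleton_above
    (hthm3 : thm3_twistDeformation_cohomology_addEquiv) (hSf : S.Finite)
    (hκ : Function.Surjective fun σ : absoluteGaloisGroup K ↦ (κ₁ σ, κ₂ σ))
    (hA : ∀ a : A, ∃ k : ℕ, p ^ k • a = 0)
    (hH2 : Subsingleton
      ((ρ₀.restrict (galoisGroupAboveSubtype S (multiZpKer p ![κ₁, κ₂]))).H 2)) :
    Subsingleton ((twistDeformation S hS κ₁ κ₂ ρ₀).H 2) :=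
  hthm3.subsingleton hSf hS hκ ρ₀ (exists_zpow_smul_eq_zero_of_nsmul hA) 2 hH2

/-- **LEO(`𝐃`) and `corank_Λ H²(K_Σ/K, 𝐃) = 0` from `H²(K_Σ/K̃_∞, A) = 0`**: `Ш²(K, Σ, 𝐃) ≤
H²(K_Σ/K, 𝐃) = 0` is (co)torsion and the corank of `0` is `0` — the two named hypotheses `hLEO`,
`h2` of `twistDeformation_fullAtSelmer_isAlmostDivisible` reduced to ONE vanishing above the tower
(weak Leopoldt for the twisted coefficient, RULING L60 (2) road "Sh").
[cite: Greenberg2016Selmer, §2.2 p. 6 L22–35 (LEO)] [cite: Greenberg2006, Thm. 3 p. 342; pp. 343–344] -/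
theorem LEO_and_hasCorank_H2_zero_of_subsingleton_above
    (hthm3 : thm3_twistDeformation_cohomology_addEquiv) (hSf : S.Finite)
    (hκ : Function.Surjective fun σ : absoluteGaloisGroup K ↦ (κ₁ σ, κ₂ σ))
    (hA : ∀ a : A, ∃ k : ℕ, p ^ k • a = 0)
    (hH2 : Subsingleton
      ((ρ₀.restrict (galoisGroupAboveSubtype S (multiZpKer p ![κ₁, κ₂]))).H 2)) :
    LEO S (twistDeformation S hS κ₁ κ₂ ρ₀) ∧
      HasCorank (IwasawaAlgebra₂ p) ((twistDeformation S hS κ₁ κ₂ ρ₀).H 2) 0 := by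
  haveI := subsingleton_H2_twistDeformation_of_subsingleton_above hS κ₁ κ₂ ρ₀ hthm3 hSf hκ hA hH2
  haveI : Subsingleton (sha2 S (twistDeformation S hS κ₁ κ₂ ρ₀)) :=
    ⟨fun a b ↦ Subtype.ext (Subsingleton.elim _ _)⟩
  exact ⟨Greenberg2016.isCotorsion_of_subsingleton, Greenberg2016.hasCorank_zero_of_subsingleton⟩

end H2

/-! ## §3. The instance theorem with every tree-supplied input discharged -/

section Consumer

variable {K : Type} [Field K] [NumberField K] {S : Set (HeightOneSpectrum (𝓞 K))} {p : ℕ} [Fact p.Prime]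
  {A : Type} [AddCommGroup A] [Module ℤ_[p] A] [TopologicalSpace A] [DiscreteTopology A]
  [ContinuousSMul ℤ_[p] A]
  [TopologicalSpace (PowerSeries ℤ_[p])] [TopologicalSpace (PowerSeries (PowerSeries ℤ_[p]))]
  [IsTopologicalRing (PowerSeries (PowerSeries ℤ_[p]))]
  [IsTopologicalAddGroup (IndModule₂ ℤ_[p] p A)]
  [ContinuousSMul (PowerSeries (PowerSeries ℤ_[p])) (IndModule₂ ℤ_[p] p A)]
  (hS : ∀ v : HeightOneSpectrum (𝓞 K), ((p : ℕ) : 𝓞 K) ∈ v.asIdeal → v ∈ S)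
  (κ₁ κ₂ : ZpExtension K p) (ρ₀ : ContinuousRep (GaloisGroupUnramifiedOutside K S) ℤ_[p] A)

/-- **Prop. 4.1.1 (c) AT THE INSTANCE, inputs consumed — `S_{𝓛_𝔭}(K, 𝐃)` is almost divisible for
the twist deformation `𝐃 = Ind_{K̃_∞/K}(A)` of ANY `A ≃ ℚ_p/ℤ_p` (as a `ℤ_p`-module) on which
`G_{K,S}` acts by a character, over the `ℤ_p²`-tower `K̃_∞` (cut out by a jointly surjective pair
`κ₁, κ₂`) of an IMAGINARY QUADRATIC `K` in which `p = 𝔭𝔭̄` splits**, granted: seven published facts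
(Greenberg 2016 Props. 4.1.1, 4.2.2; Greenberg 2006 Props. 3.2, 4.1, 4.2, §5 A, Thm. 3); the
vanishing `H²(K_Σ/K̃_∞, A) = 0`; and `corank_Λ S_{𝓛_𝔭}(K, 𝐃) = 0`. Relative to
`twistDeformation_fullAtSelmer_isAlmostDivisible` the following are DISCHARGED here: `hA`, `jQ`,
`hinjQ`, `hsurjQ`, `jU`, `hinjU`, `hsurjU`, `hcyc` (Prüfer/Tate duality of `ℚ_p/ℤ_p`, one
`e : A ≃ₗ[ℤ_p] ℚ_p/ℤ_p`), `hsup` (no finite prime splits completely in `K̃_∞`), `hcfg` (Prop. 3.2),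
`hK`, `hr₂`, `hdeg`, `hSp` (imaginary quadratic, `p` split), `hLEO`, `h2` (Thm. 3, degree 2).
[cite: Greenberg2016Selmer, Prop. 4.1.1 (c) (§4.1 p. 15 L21–32), §4.3 p. 20 L19–30]
[cite: Greenberg2006, Thm. 3 p. 342, Prop. 3.2 p. 358, Props. 4.1–4.2 (§4 A pp. 367–368), §5 A (p. 373)] -/
theorem twistDeformation_fullAtSelmer_isAlmostDivisible_of_linearEquiv
    (h411 : prop411_selmer_isAlmostDivisible) (h422 : prop422_localCohomology_isAlmostDivisible)
    (h5A : sec5A_localH2_subsingleton_of_LOC1) (h41 : prop41_globalEulerPoincareCorank)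
    (h42 : prop42_localEulerPoincareCorank) (h32 : prop32_cohomology_isCofinitelyGenerated)
    (hthm3 : thm3_twistDeformation_cohomology_addEquiv)
    (hSf : S.Finite) (hK : IsImaginaryQuadratic K)
    (hκ : Function.Surjective fun σ : absoluteGaloisGroup K ↦ (κ₁ σ, κ₂ σ))
    (e : A ≃ₗ[ℤ_[p]] QpModZp p)
    (hscalar : ∀ g : GaloisGroupUnramifiedOutside K S, ∃ t : ℤ_[p]ˣ, ∀ a : A, ρ₀ g a = (t : ℤ_[p]) • a)
    {𝔭 𝔭bar : HeightOneSpectrum (𝓞 K)} (hne : 𝔭bar ≠ 𝔭)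
    (hp𝔭 : ((p : ℕ) : 𝓞 K) ∈ 𝔭.asIdeal) (hp𝔭bar : ((p : ℕ) : 𝓞 K) ∈ 𝔭bar.asIdeal)
    -- the named remainder
    (hH2 : Subsingleton
      ((ρ₀.restrict (galoisGroupAboveSubtype S (multiZpKer p ![κ₁, κ₂]))).H 2))
    (hSel : HasCorank (IwasawaAlgebra₂ p)
      (fullAtSpecification S (twistDeformation S hS κ₁ κ₂ ρ₀) (Sum.inr 𝔭)).selmer 0) :
    Greenberg2016.IsAlmostDivisible (IwasawaAlgebra₂ p)
      (fullAtSpecification S (twistDeformation S hS κ₁ κ₂ ρ₀) (Sum.inr 𝔭)).selmer := by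
  -- the instance data from ONE `e : A ≃ₗ[ℤ_p] ℚ_p/ℤ_p` (Prüfer brick)
  obtain ⟨hA, jQ, -, hinjQ, hsurjQ⟩ := QpModZp.exists_character_hinj_hsurj_of_linearEquiv e
  obtain ⟨jU, -, hinjU, hsurjU⟩ := QpModZp.exists_unitsCarrier_hinj_hsurj_of_linearEquiv K e
  have hcyc : ∀ (v : Place K) (σ : absoluteGaloisGroup v.Completion), ∃ u : ℤ_[p], ∀ a : A,
      DiscreteGaloisModule.units K (absGaloisRestrict K v.Completion σ) (jU a) = jU (u • a) :=
    fun v σ ↦ QpModZp.exists_units_apply_eq_smul K jU hsurjU _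
  -- the `σ`-supply (no finite prime splits completely in `K̃_∞`)
  have hsup : ∀ v : HeightOneSpectrum (𝓞 K), v ∈ S →
      ∃ σ : absoluteGaloisGroup (Place.Completion (Sum.inr v : Place K)),
        κ₁ (absGaloisRestrict K _ σ) ≠ 1 ∨ κ₂ (absGaloisRestrict K _ σ) ≠ 1 :=
    fun v _ ↦ exists_resGal_apply_ne_one_of_surjective K p hK.1.le hκ v
  -- `K` imaginary quadratic, `p` split
  haveI := hK.2
  have hKc : ∀ w : InfinitePlace K, w.IsComplex := IsTotallyComplex.isComplex
  have hr₂ := nrComplexPlaces_eq_one_of_isImaginaryQuadratic hK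
  have hdeg : 𝔭bar.asIdeal.ramificationIdx ℤ * 𝔭bar.asIdeal.inertiaDeg ℤ = 1 :=
    (ncard_primesOver_eq_two_and_deg_one_of_ne hK.1 hp𝔭 hp𝔭bar hne).2 hp𝔭bar
  have hSp : ∀ v : HeightOneSpectrum (𝓞 K), v ∈ S → ((p : ℕ) : 𝓞 K) ∈ v.asIdeal →
      v = 𝔭 ∨ v = 𝔭bar := fun v _ hv ↦ eq_or_eq_of_natCast_mem_of_ne hK.1 hp𝔭 hp𝔭bar hne hv
  -- LEO and `h₂ = 0` through Thm. 3
  obtain ⟨hLEO, h2⟩ :=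
    LEO_and_hasCorank_H2_zero_of_subsingleton_above hS κ₁ κ₂ ρ₀ hthm3 hSf hκ hA hH2
  -- cofinite generation of the local `H¹` (Prop. 3.2)
  have hcfg : ∀ v : HeightOneSpectrum (𝓞 K), v ∈ S → v ≠ 𝔭 → v ≠ 𝔭bar →
      IsCofinitelyGenerated (IwasawaAlgebra₂ p)
        ((localRep S (twistDeformation S hS κ₁ κ₂ ρ₀) (Sum.inr v)).H 1) := fun v _ _ _ ↦
    h32.local hSf hS (nonempty_iwasawaAlgebraTwoVar_ringEquiv_mvPowerSeries p)
      (twistDeformation S hS κ₁ κ₂ ρ₀) IndModule₂.exists_pow_smul_eq_zero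
      (isCofinitelyGenerated_indModule₂ hA jQ hinjQ hsurjQ) (Sum.inr v) 1
  exact twistDeformation_fullAtSelmer_isAlmostDivisible hS κ₁ κ₂ ρ₀ h411 h422 h5A h41 h42 hSf hKc
    hr₂ hA jQ hinjQ hsurjQ jU hinjU hsurjU hscalar hcyc hsup (hS 𝔭 hp𝔭) (hS 𝔭bar hp𝔭bar) hne
    hp𝔭bar hdeg hSp hLEO h2 hSel hcfg

end Consumer

end Summit.BirchSwinnertonDyer.BirchSwinnertonDyer.Theorems.GreenbergFullAtSelmer

end
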